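import Mathlib
import HarnessLib
import Summits.ValiantsHypothesis.ValiantsHypothesis.Theorems.SymmetroidPencilBasics

/-!
# ValiantsHypothesis / LacunarySymmetroid — crux `MatrixDescartes` (stmt-ValiantsHypothesis-18050, V1),
# line «definite-pair-fold-law» (`Cruxes/MatrixDescartes/Lines/definite_pair_fold_law.lean`, val-idea-2):
# STUB 3 `stub_generic` REDUCED TO DENSITY OF ADMISSIBLE SPLITS

The line's STUB 3 is
`stub_generic (hM : MorseInequality) : ∀ m K B, FoldLawAt m K B → AltLawAt m K (m + B)`
(«sign split, density of general position inside the format, persistence of alternations»; desk packet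
2026-08-28: «unseated — first helper = finite-point sign-persistence lemma»).  This file proves the two
theorem-sized parts and isolates the genericity as ONE hypothesis:

* `altLaw_of_foldLaw_of_dense` (ABSTRACT form): for a fixed support `d`, ANY admissibility predicate
  `Adm S P Q` with (i) `Adm S P Q → S = P − Q` letterwise, (ii) a Morse bound
  `#Z₊(det Σ x^{d_l}(P_l − Q_l)) ≤ m + κ(P,Q)` on admissible splits, (iii) the fold law at `d`
  («a pencil with an admissible split has one with `κ ≤ B`») and (iv) DENSITY («every neighbourhood of a
  symmetric pencil contains a symmetric pencil with an admissible split») forces `N ≤ m + B` for every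
  symmetric pencil with `N` strict sign alternations of its determinant along positive points.  Proof =
  FINITE-POINT SIGN PERSISTENCE (the `N + 1` strict inequalities define an open set of pencils, by continuity
  of `S ↦ det Σ τ^{d_l} S_l`) + density + fold law + Morse + IVT
  (`SymmetroidDescartes.le_card_posRoots_of_alternating`).
* `alternates_eq_zero_of_const_support`: on a CONSTANT exponent vector (including `K = 0`) the determinant is
  a monomial `x^{me}·det(Σ S_l)`, so it has NO strict alternation — the supports where density fails
  trivially (every split has constant eigenvalue branches, no admissible split exists) need none.
* `stub_generic_of_dense` (ASSEMBLED, line vocabulary UNFOLDED verbatim: `MorseInequality`, `FoldLawAt`,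
  `AltLawAt`, `Admissible`, `IsDefinitePair`, `SimpleSpectrum`, `foldSet`, `pairPoly`, `euler`, `pencilDet`,
  `posRootsCard`, `Alternates`): `AdmissibleDense → MorseInequality → ∀ m K B, FoldLawAt m K B → AltLawAt m K (m + B)`,
  where `AdmissibleDense` (spelled out as the first hypothesis, no definition introduced) says: for every
  NON-constant support `d` and every symmetric pencil `S` on it, every neighbourhood of `S` contains a symmetric
  pencil admitting an admissible split.  So the line's `stub_generic` closes by
  `fun hM => FoldLaw.stub_generic_of_dense ‹density› hM` once the density statement is registered as the
  line's honest genericity stub (line owner's call; codimension-two eigenvalue-crossing avoidance along a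
  one-parameter family — NOT proved here).

Honest framing: helper layer of a LAW line; the density statement, the fold law `stub_foldLaw`, Conjecture B,
the crux `MatrixDescartes` and `VP ≠ VNP` are OPEN / NOT proved and not moved by this file.  No definitions,
no named facts; Mathlib + `SymmetroidPencilBasics` only.
-/

-- `Summit.ValiantsHypothesis.ValiantsHypothesis.…` is the tree's mandated single-conjunct layout (Sub = Summit).
set_option linter.dupNamespace false

noncomputable section

namespace Summit.ValiantsHypothesis.ValiantsHypothesis.Theorems.LacunarySymmetroidMatrixDescartes.FoldLaw

open Polynomial Matrix Filter
open scoped BigOperators Topology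

/-! ### Finite-point sign persistence -/

/-- The real pencil value `S ↦ det (Σ_l t^{d l} • S l)` is continuous in the letters. [folklore] -/
theorem continuous_det_pencil_at {m K : ℕ} (d : Fin K → ℕ) (t : ℝ) :
    Continuous fun S : Fin K → Matrix (Fin m) (Fin m) ℝ => (∑ l, t ^ d l • S l).det := by
  have h : Continuous fun S : Fin K → Matrix (Fin m) (Fin m) ℝ => ∑ l, t ^ d l • S l :=
    continuous_finsetSum _ fun l _ => (continuous_apply l).const_smul (t ^ d l)
  exact h.matrix_det

/-- **Finite-point sign persistence.**  The pencils whose determinant has the strict sign pattern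
`det(τ_i)·det(τ_{i+1}) < 0` at finitely many prescribed points form an OPEN set. [folklore] -/
theorem isOpen_alternating_pencils {m K : ℕ} (d : Fin K → ℕ) {N : ℕ} (τ : Fin (N + 1) → ℝ) :
    IsOpen {S : Fin K → Matrix (Fin m) (Fin m) ℝ | ∀ i : Fin N,
      (∑ l, τ i.castSucc ^ d l • S l).det * (∑ l, τ i.succ ^ d l • S l).det < 0} := by
  rw [show {S : Fin K → Matrix (Fin m) (Fin m) ℝ | ∀ i : Fin N,
      (∑ l, τ i.castSucc ^ d l • S l).det * (∑ l, τ i.succ ^ d l • S l).det < 0} =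
      ⋂ i : Fin N, {S | (∑ l, τ i.castSucc ^ d l • S l).det * (∑ l, τ i.succ ^ d l • S l).det < 0} by
    ext S; simp]
  exact isOpen_iInter_of_finite fun i =>
    isOpen_lt ((continuous_det_pencil_at d _).mul (continuous_det_pencil_at d _)) continuous_const

/-! ### The abstract reduction -/

/-- **Alternation budget from a fold law, Morse and DENSITY (abstract admissibility).**  See the module
docstring. [folklore] -/
theorem altLaw_of_foldLaw_of_dense {m K : ℕ} (d : Fin K → ℕ) (B : ℕ)
    (Adm : (Fin K → Matrix (Fin m) (Fin m) ℝ) → (Fin K → Matrix (Fin m) (Fin m) ℝ) →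
      (Fin K → Matrix (Fin m) (Fin m) ℝ) → Prop)
    (κ : (Fin K → Matrix (Fin m) (Fin m) ℝ) → (Fin K → Matrix (Fin m) (Fin m) ℝ) → ℕ)
    (hsplit : ∀ S P Q, Adm S P Q → ∀ l, S l = P l - Q l)
    (hMorse : ∀ S P Q, Adm S P Q →
      ((∑ l, (X : ℝ[X]) ^ d l • (P l - Q l).map Polynomial.C).det.roots.toFinset.filter
        (fun t => 0 < t)).card ≤ m + κ P Q)
    (hFold : ∀ S, (∀ l, (S l).IsSymm) → (∃ P Q, Adm S P Q) → ∃ P Q, Adm S P Q ∧ κ P Q ≤ B)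
    (hDense : ∀ S, (∀ l, (S l).IsSymm) → ∀ U ∈ 𝓝 S, ∃ S' ∈ U, (∀ l, (S' l).IsSymm) ∧ ∃ P Q, Adm S' P Q)
    (S : Fin K → Matrix (Fin m) (Fin m) ℝ) (hS : ∀ l, (S l).IsSymm) (N : ℕ) (τ : Fin (N + 1) → ℝ)
    (hτ : StrictMono τ) (hτpos : ∀ i, 0 < τ i)
    (halt : ∀ i : Fin N, (∑ l, (X : ℝ[X]) ^ d l • (S l).map Polynomial.C).det.eval (τ i.castSucc) *
      (∑ l, (X : ℝ[X]) ^ d l • (S l).map Polynomial.C).det.eval (τ i.succ) < 0) :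
    N ≤ m + B := by
  classical
  -- the open set of pencils alternating at the points `τ`
  set V := {S' : Fin K → Matrix (Fin m) (Fin m) ℝ | ∀ i : Fin N,
      (∑ l, τ i.castSucc ^ d l • S' l).det * (∑ l, τ i.succ ^ d l • S' l).det < 0} with hV
  have hSV : S ∈ V := by
    intro i
    have h := halt i
    rwa [SymmetroidDescartes.eval_det_pencil, SymmetroidDescartes.eval_det_pencil] at h
  have hVn : V ∈ 𝓝 S := (isOpen_alternating_pencils d τ).mem_nhds hSV
  -- a nearby symmetric pencil with an admissible split, then a split with few folds
  obtain ⟨S', hS'V, hS's, hadm⟩ := hDense S hS V hVn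
  obtain ⟨P, Q, hA, hκ⟩ := hFold S' hS's hadm
  have hPQ : (fun l => P l - Q l) = S' := funext fun l => (hsplit S' P Q hA l).symm
  have hM := hMorse S' P Q hA
  have hM' : ((∑ l, (X : ℝ[X]) ^ d l • (S' l).map Polynomial.C).det.roots.toFinset.filter
      (fun t => 0 < t)).card ≤ m + κ P Q := by
    have h := hM
    simp only [show ∀ l, P l - Q l = S' l from fun l => (hsplit S' P Q hA l).symm] at h
    exact h
  -- alternation of `det S'` at `τ`, then IVT
  have halt' : ∀ i : Fin N, (∑ l, (X : ℝ[X]) ^ d l • (S' l).map Polynomial.C).det.eval (τ i.castSucc) *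
      (∑ l, (X : ℝ[X]) ^ d l • (S' l).map Polynomial.C).det.eval (τ i.succ) < 0 := by
    intro i
    rw [SymmetroidDescartes.eval_det_pencil, SymmetroidDescartes.eval_det_pencil]
    exact hS'V i
  have hN := SymmetroidDescartes.le_card_posRoots_of_alternating _ N τ hτ hτpos halt'
  omega

/-! ### Constant supports carry no alternation -/

/-- On a constant exponent vector the pencil determinant is the monomial `X^(e·m) · det(Σ S_l)`. [folklore] -/
theorem det_pencil_const_support {m K : ℕ} (d : Fin K → ℕ) (e : ℕ) (hd : ∀ l, d l = e)
    (S : Fin K → Matrix (Fin m) (Fin m) ℝ) (t : ℝ) :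
    (∑ l, (X : ℝ[X]) ^ d l • (S l).map Polynomial.C).det.eval t = t ^ (e * m) * (∑ l, S l).det := by
  rw [SymmetroidDescartes.eval_det_pencil]
  have h : (∑ l, t ^ d l • S l) = t ^ e • ∑ l, S l := by
    rw [Finset.smul_sum]
    exact Finset.sum_congr rfl fun l _ => by rw [hd l]
  rw [h, Matrix.det_smul, Fintype.card_fin, pow_mul]

/-- **No strict alternation on a constant support** (in particular for `K = 0`): a pencil all of whose
exponents coincide has determinant `x^{me}·c`, whose values at two positive points never have a negative
product. [folklore] -/
theorem alternates_eq_zero_of_const_support {m K : ℕ} (d : Fin K → ℕ) (hd : ∀ l l', d l = d l')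
    (S : Fin K → Matrix (Fin m) (Fin m) ℝ) (N : ℕ) (τ : Fin (N + 1) → ℝ) (hτpos : ∀ i, 0 < τ i)
    (halt : ∀ i : Fin N, (∑ l, (X : ℝ[X]) ^ d l • (S l).map Polynomial.C).det.eval (τ i.castSucc) *
      (∑ l, (X : ℝ[X]) ^ d l • (S l).map Polynomial.C).det.eval (τ i.succ) < 0) :
    N = 0 := by
  rcases Nat.eq_zero_or_pos N with h | hN
  · exact h
  exfalso
  set i : Fin N := ⟨0, hN⟩
  have h := halt i
  rcases Nat.eq_zero_or_pos K with hK | hK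
  · subst hK
    have hdet : ∀ t : ℝ, (∑ l, (X : ℝ[X]) ^ d l • (S l).map Polynomial.C).det.eval t =
        (0 : Matrix (Fin m) (Fin m) ℝ).det := by
      intro t
      rw [SymmetroidDescartes.eval_det_pencil]
      simp
    rw [hdet, hdet] at h
    exact absurd h (not_lt.2 (mul_self_nonneg _))
  · set e := d ⟨0, hK⟩
    have hde : ∀ l, d l = e := fun l => hd l _
    rw [det_pencil_const_support d e hde S, det_pencil_const_support d e hde S] at h
    have h1 : 0 < τ i.castSucc ^ (e * m) := pow_pos (hτpos _) _
    have h2 : 0 < τ i.succ ^ (e * m) := pow_pos (hτpos _) _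
    nlinarith [mul_self_nonneg (∑ l, S l).det, mul_pos h1 h2]

/-! ### The assembled reduction in the line's vocabulary (unfolded) -/

/-- **`stub_generic` modulo density** — statement = the line's
`MorseInequality → ∀ m K B, FoldLawAt m K B → AltLawAt m K (m + B)` with every line definition unfolded, under
the first hypothesis = DENSITY OF ADMISSIBLE SPLITS on non-constant supports (the honest genericity residue,
spelled out).  See the module docstring. [folklore] -/
theorem stub_generic_of_dense
    (hDense : ∀ (m K : ℕ) (d : Fin K → ℕ), (∃ l l', d l ≠ d l') →
      ∀ S : Fin K → Matrix (Fin m) (Fin m) ℝ, (∀ l, (S l).IsSymm) → ∀ U ∈ 𝓝 S,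
        ∃ S' ∈ U, (∀ l, (S' l).IsSymm) ∧ ∃ P Q : Fin K → Matrix (Fin m) (Fin m) ℝ,
          (((∀ l, (P l).PosSemidef) ∧ (∀ l, (Q l).PosSemidef) ∧ (∑ l, P l).PosDef ∧ (∑ l, Q l).PosDef) ∧
          (∀ l, S' l = P l - Q l) ∧
          (∀ p : Fin 2 → ℝ, 0 < p 0 →
            MvPolynomial.eval p (∑ l, (MvPolynomial.X (0 : Fin 2) : MvPolynomial (Fin 2) ℝ) ^ d l •
              ((P l).map (MvPolynomial.C : ℝ →+* MvPolynomial (Fin 2) ℝ)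
                - (MvPolynomial.X (1 : Fin 2) : MvPolynomial (Fin 2) ℝ) •
                  (Q l).map (MvPolynomial.C : ℝ →+* MvPolynomial (Fin 2) ℝ))).det = 0 →
            MvPolynomial.eval p (MvPolynomial.pderiv 1
              (∑ l, (MvPolynomial.X (0 : Fin 2) : MvPolynomial (Fin 2) ℝ) ^ d l •
              ((P l).map (MvPolynomial.C : ℝ →+* MvPolynomial (Fin 2) ℝ)
                - (MvPolynomial.X (1 : Fin 2) : MvPolynomial (Fin 2) ℝ) •
                  (Q l).map (MvPolynomial.C : ℝ →+* MvPolynomial (Fin 2) ℝ))).det) ≠ 0) ∧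
          {p : Fin 2 → ℝ | 0 < p 0 ∧ 0 < p 1 ∧
            MvPolynomial.eval p (∑ l, (MvPolynomial.X (0 : Fin 2) : MvPolynomial (Fin 2) ℝ) ^ d l •
              ((P l).map (MvPolynomial.C : ℝ →+* MvPolynomial (Fin 2) ℝ)
                - (MvPolynomial.X (1 : Fin 2) : MvPolynomial (Fin 2) ℝ) •
                  (Q l).map (MvPolynomial.C : ℝ →+* MvPolynomial (Fin 2) ℝ))).det = 0 ∧
            MvPolynomial.eval p (MvPolynomial.X 0 * MvPolynomial.pderiv 0
              (∑ l, (MvPolynomial.X (0 : Fin 2) : MvPolynomial (Fin 2) ℝ) ^ d l •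
              ((P l).map (MvPolynomial.C : ℝ →+* MvPolynomial (Fin 2) ℝ)
                - (MvPolynomial.X (1 : Fin 2) : MvPolynomial (Fin 2) ℝ) •
                  (Q l).map (MvPolynomial.C : ℝ →+* MvPolynomial (Fin 2) ℝ))).det) = 0}.Finite))
    (hM : ∀ (m K : ℕ) (d : Fin K → ℕ) (P Q : Fin K → Matrix (Fin m) (Fin m) ℝ),
      ((∀ l, (P l).PosSemidef) ∧ (∀ l, (Q l).PosSemidef) ∧ (∑ l, P l).PosDef ∧ (∑ l, Q l).PosDef) →
      (∀ p : Fin 2 → ℝ, 0 < p 0 →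
        MvPolynomial.eval p (∑ l, (MvPolynomial.X (0 : Fin 2) : MvPolynomial (Fin 2) ℝ) ^ d l •
          ((P l).map (MvPolynomial.C : ℝ →+* MvPolynomial (Fin 2) ℝ)
            - (MvPolynomial.X (1 : Fin 2) : MvPolynomial (Fin 2) ℝ) •
              (Q l).map (MvPolynomial.C : ℝ →+* MvPolynomial (Fin 2) ℝ))).det = 0 →
        MvPolynomial.eval p (MvPolynomial.pderiv 1
          (∑ l, (MvPolynomial.X (0 : Fin 2) : MvPolynomial (Fin 2) ℝ) ^ d l •
          ((P l).map (MvPolynomial.C : ℝ →+* MvPolynomial (Fin 2) ℝ)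
            - (MvPolynomial.X (1 : Fin 2) : MvPolynomial (Fin 2) ℝ) •
              (Q l).map (MvPolynomial.C : ℝ →+* MvPolynomial (Fin 2) ℝ))).det) ≠ 0) →
      {p : Fin 2 → ℝ | 0 < p 0 ∧ 0 < p 1 ∧
        MvPolynomial.eval p (∑ l, (MvPolynomial.X (0 : Fin 2) : MvPolynomial (Fin 2) ℝ) ^ d l •
          ((P l).map (MvPolynomial.C : ℝ →+* MvPolynomial (Fin 2) ℝ)
            - (MvPolynomial.X (1 : Fin 2) : MvPolynomial (Fin 2) ℝ) •
              (Q l).map (MvPolynomial.C : ℝ →+* MvPolynomial (Fin 2) ℝ))).det = 0 ∧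
        MvPolynomial.eval p (MvPolynomial.X 0 * MvPolynomial.pderiv 0
          (∑ l, (MvPolynomial.X (0 : Fin 2) : MvPolynomial (Fin 2) ℝ) ^ d l •
          ((P l).map (MvPolynomial.C : ℝ →+* MvPolynomial (Fin 2) ℝ)
            - (MvPolynomial.X (1 : Fin 2) : MvPolynomial (Fin 2) ℝ) •
              (Q l).map (MvPolynomial.C : ℝ →+* MvPolynomial (Fin 2) ℝ))).det) = 0}.Finite →
      ((∑ l, (X : ℝ[X]) ^ d l • (P l - Q l).map Polynomial.C).det.roots.toFinset.filter
        (fun t => 0 < t)).card ≤ m +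
      {p : Fin 2 → ℝ | 0 < p 0 ∧ 0 < p 1 ∧
        MvPolynomial.eval p (∑ l, (MvPolynomial.X (0 : Fin 2) : MvPolynomial (Fin 2) ℝ) ^ d l •
          ((P l).map (MvPolynomial.C : ℝ →+* MvPolynomial (Fin 2) ℝ)
            - (MvPolynomial.X (1 : Fin 2) : MvPolynomial (Fin 2) ℝ) •
              (Q l).map (MvPolynomial.C : ℝ →+* MvPolynomial (Fin 2) ℝ))).det = 0 ∧
        MvPolynomial.eval p (MvPolynomial.X 0 * MvPolynomial.pderiv 0
          (∑ l, (MvPolynomial.X (0 : Fin 2) : MvPolynomial (Fin 2) ℝ) ^ d l •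
          ((P l).map (MvPolynomial.C : ℝ →+* MvPolynomial (Fin 2) ℝ)
            - (MvPolynomial.X (1 : Fin 2) : MvPolynomial (Fin 2) ℝ) •
              (Q l).map (MvPolynomial.C : ℝ →+* MvPolynomial (Fin 2) ℝ))).det) = 0}.ncard) :
    ∀ m K B : ℕ,
      (∀ (d : Fin K → ℕ) (S : Fin K → Matrix (Fin m) (Fin m) ℝ), (∀ l, (S l).IsSymm) →
        (∃ P Q : Fin K → Matrix (Fin m) (Fin m) ℝ,
          (((∀ l, (P l).PosSemidef) ∧ (∀ l, (Q l).PosSemidef) ∧ (∑ l, P l).PosDef ∧ (∑ l, Q l).PosDef) ∧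
          (∀ l, S l = P l - Q l) ∧
          (∀ p : Fin 2 → ℝ, 0 < p 0 →
            MvPolynomial.eval p (∑ l, (MvPolynomial.X (0 : Fin 2) : MvPolynomial (Fin 2) ℝ) ^ d l •
              ((P l).map (MvPolynomial.C : ℝ →+* MvPolynomial (Fin 2) ℝ)
                - (MvPolynomial.X (1 : Fin 2) : MvPolynomial (Fin 2) ℝ) •
                  (Q l).map (MvPolynomial.C : ℝ →+* MvPolynomial (Fin 2) ℝ))).det = 0 →
            MvPolynomial.eval p (MvPolynomial.pderiv 1
              (∑ l, (MvPolynomial.X (0 : Fin 2) : MvPolynomial (Fin 2) ℝ) ^ d l •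
              ((P l).map (MvPolynomial.C : ℝ →+* MvPolynomial (Fin 2) ℝ)
                - (MvPolynomial.X (1 : Fin 2) : MvPolynomial (Fin 2) ℝ) •
                  (Q l).map (MvPolynomial.C : ℝ →+* MvPolynomial (Fin 2) ℝ))).det) ≠ 0) ∧
          {p : Fin 2 → ℝ | 0 < p 0 ∧ 0 < p 1 ∧
            MvPolynomial.eval p (∑ l, (MvPolynomial.X (0 : Fin 2) : MvPolynomial (Fin 2) ℝ) ^ d l •
              ((P l).map (MvPolynomial.C : ℝ →+* MvPolynomial (Fin 2) ℝ)
                - (MvPolynomial.X (1 : Fin 2) : MvPolynomial (Fin 2) ℝ) •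
                  (Q l).map (MvPolynomial.C : ℝ →+* MvPolynomial (Fin 2) ℝ))).det = 0 ∧
            MvPolynomial.eval p (MvPolynomial.X 0 * MvPolynomial.pderiv 0
              (∑ l, (MvPolynomial.X (0 : Fin 2) : MvPolynomial (Fin 2) ℝ) ^ d l •
              ((P l).map (MvPolynomial.C : ℝ →+* MvPolynomial (Fin 2) ℝ)
                - (MvPolynomial.X (1 : Fin 2) : MvPolynomial (Fin 2) ℝ) •
                  (Q l).map (MvPolynomial.C : ℝ →+* MvPolynomial (Fin 2) ℝ))).det) = 0}.Finite)) →
        ∃ P Q : Fin K → Matrix (Fin m) (Fin m) ℝ,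
          ((((∀ l, (P l).PosSemidef) ∧ (∀ l, (Q l).PosSemidef) ∧ (∑ l, P l).PosDef ∧ (∑ l, Q l).PosDef) ∧
          (∀ l, S l = P l - Q l) ∧
          (∀ p : Fin 2 → ℝ, 0 < p 0 →
            MvPolynomial.eval p (∑ l, (MvPolynomial.X (0 : Fin 2) : MvPolynomial (Fin 2) ℝ) ^ d l •
              ((P l).map (MvPolynomial.C : ℝ →+* MvPolynomial (Fin 2) ℝ)
                - (MvPolynomial.X (1 : Fin 2) : MvPolynomial (Fin 2) ℝ) •
                  (Q l).map (MvPolynomial.C : ℝ →+* MvPolynomial (Fin 2) ℝ))).det = 0 →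
            MvPolynomial.eval p (MvPolynomial.pderiv 1
              (∑ l, (MvPolynomial.X (0 : Fin 2) : MvPolynomial (Fin 2) ℝ) ^ d l •
              ((P l).map (MvPolynomial.C : ℝ →+* MvPolynomial (Fin 2) ℝ)
                - (MvPolynomial.X (1 : Fin 2) : MvPolynomial (Fin 2) ℝ) •
                  (Q l).map (MvPolynomial.C : ℝ →+* MvPolynomial (Fin 2) ℝ))).det) ≠ 0) ∧
          {p : Fin 2 → ℝ | 0 < p 0 ∧ 0 < p 1 ∧
            MvPolynomial.eval p (∑ l, (MvPolynomial.X (0 : Fin 2) : MvPolynomial (Fin 2) ℝ) ^ d l •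
              ((P l).map (MvPolynomial.C : ℝ →+* MvPolynomial (Fin 2) ℝ)
                - (MvPolynomial.X (1 : Fin 2) : MvPolynomial (Fin 2) ℝ) •
                  (Q l).map (MvPolynomial.C : ℝ →+* MvPolynomial (Fin 2) ℝ))).det = 0 ∧
            MvPolynomial.eval p (MvPolynomial.X 0 * MvPolynomial.pderiv 0
              (∑ l, (MvPolynomial.X (0 : Fin 2) : MvPolynomial (Fin 2) ℝ) ^ d l •
              ((P l).map (MvPolynomial.C : ℝ →+* MvPolynomial (Fin 2) ℝ)
                - (MvPolynomial.X (1 : Fin 2) : MvPolynomial (Fin 2) ℝ) •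
                  (Q l).map (MvPolynomial.C : ℝ →+* MvPolynomial (Fin 2) ℝ))).det) = 0}.Finite) ∧
          {p : Fin 2 → ℝ | 0 < p 0 ∧ 0 < p 1 ∧
            MvPolynomial.eval p (∑ l, (MvPolynomial.X (0 : Fin 2) : MvPolynomial (Fin 2) ℝ) ^ d l •
              ((P l).map (MvPolynomial.C : ℝ →+* MvPolynomial (Fin 2) ℝ)
                - (MvPolynomial.X (1 : Fin 2) : MvPolynomial (Fin 2) ℝ) •
                  (Q l).map (MvPolynomial.C : ℝ →+* MvPolynomial (Fin 2) ℝ))).det = 0 ∧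
            MvPolynomial.eval p (MvPolynomial.X 0 * MvPolynomial.pderiv 0
              (∑ l, (MvPolynomial.X (0 : Fin 2) : MvPolynomial (Fin 2) ℝ) ^ d l •
              ((P l).map (MvPolynomial.C : ℝ →+* MvPolynomial (Fin 2) ℝ)
                - (MvPolynomial.X (1 : Fin 2) : MvPolynomial (Fin 2) ℝ) •
                  (Q l).map (MvPolynomial.C : ℝ →+* MvPolynomial (Fin 2) ℝ))).det) = 0}.ncard ≤ B)) →
      ∀ (d : Fin K → ℕ) (S : Fin K → Matrix (Fin m) (Fin m) ℝ), (∀ l, (S l).IsSymm) →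
        ∀ N : ℕ,
          (∃ τ : Fin (N + 1) → ℝ, StrictMono τ ∧ (∀ i, 0 < τ i) ∧
            ∀ i : Fin N, (∑ l, (X : ℝ[X]) ^ d l • (S l).map Polynomial.C).det.eval (τ i.castSucc) *
              (∑ l, (X : ℝ[X]) ^ d l • (S l).map Polynomial.C).det.eval (τ i.succ) < 0) →
          N ≤ m + B := by
  intro m K B hF d S hS N hN
  obtain ⟨τ, hτ, hτpos, halt⟩ := hN
  by_cases hconst : ∀ l l', d l = d l'
  · rw [alternates_eq_zero_of_const_support d hconst S N τ hτpos halt]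
    exact Nat.zero_le _
  · push Not at hconst
    refine altLaw_of_foldLaw_of_dense d B (fun S' P Q => _ ∧ (∀ l, S' l = P l - Q l) ∧ _ ∧ _)
      (fun P Q => Set.ncard _) (fun S' P Q hA => hA.2.1)
      (fun S' P Q hA => hM m K d P Q hA.1 hA.2.2.1 hA.2.2.2) (hF d) (hDense m K d hconst) S hS N τ hτ hτpos
      halt

end Summit.ValiantsHypothesis.ValiantsHypothesis.Theorems.LacunarySymmetroidMatrixDescartes.FoldLaw
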